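import Summits.QuantumFields.YangMills.Theorems.UnitScaleTiltHalvingHSiteTopH42Datum
import HarnessLib

/-!
# Line H (`BirthV10.stub_halvingStep`, stmt-QuantumFields-19200) — «HTOP-CLOSE»: THE COMPOSERS' `HTOP` SOCKET CLOSED AT THE MEMBER
# (`htopSocket_of_member : <member data> → <HTOP socket text VERBATIM at t := 2·d(M′+ρ′)·ε₁>`, by ✓p666808 `HalvingHSiteTopH42Datum.htop_of_knitGauge`)

Cell `ym3-torus` (HUMAN RULING D-0037: YM₃ on T³ is ladder rung R3 — NOT d = 4, NOT a mass gap, NOT the Clay problem), width seat `ym-ust-19936-w2` gen 9 on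
LEAD-H ★w5-19200 g6's H-NAMER WORD 3 (3) row «HTOP-CLOSE».  `--supports stmt-QuantumFields-19200 --as helper`; THEOREMS ONLY (0 `def`, 0 `sorry`, standard axioms);
count-neutral; nothing here claims `hMember`∕PACK₄, `hSupUρ4`, the stub, the crux, the rung or the gap; the YM gap is NOT proved.

THE POINT.  The v2 (D2) per-site composers — ★w7-19200 g5's `HalvingHSiteRowsOfSocketsBaseT.siteRows_of_sockets_baseT` (`K − n = 1`) and ★w3-19200 g8's
`HalvingHSiteRowsOfSocketsT.siteRows_of_socketsT` (`2 ≤ K − n`) — display ONE socket for the top level of the dropped `H42` socket: `HTOP` (∀ `gJ u₁ W A c₁ c′ κf λ′`,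
rows 1, 2, 4–9, 14, 15, (top) of the member's ∃-body → the top budget `‖log U̿^{(k)}((U♯)^{g′})(c♭)‖ ≤ t` on every top constraint bond `c ∈ cubeLamB L a M′ ρ′ k k k`).
The two `HTOP` texts COINCIDE up to the budget letter (`t` resp. `ttop`; checked by script against the HOME bytes `ym-ust-19200-w7/…HSiteRowsOfSocketsBaseT.w7g5.lean`
:178 and `ym-ust-19200-w3/g8/…HSiteRowsOfSocketsT.w3g8.lean` :122 — the only other byte difference, `(cubeLamB … k k) k` vs `cubeLamB … k k k`, is the same term), so ONE
lemma serves both packs.  ✓p666808 `htop_of_knitGauge` (★w3-20520 g7, ε₁-route of LEAD-H LOCATE-H42-TOP §2) IS that row with the member data as hypotheses; THIS FILE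
only re-quantifies it into the socket's shape so that the member packs v2 (LEAD-H «PACK-BASE v2», ★w3-20520 g7 «PACK-STEP v2») close `HTOP` by ONE positional call,
symmetric with «WINDOWS-6» (★w8-19936 g4).
* ★ `htopSocket_of_member_le` — the socket text at ANY budget `t ≥ 2·((d·(M′+ρ′) : ℕ) : ℝ)·ε₁` (robust to the packs' choice of the `t`-letter's shape);
* ★★ `htopSocket_of_member` — at `t := 2 * ((((F.P K).d * (M′ + ρ′) : ℕ) : ℝ) * ε₁)` (✓p666808's own shape; proof = `intro …; exact htop_of_knitGauge …`);
* ★ `htopSocket_of_member'` — at `t := 2 * ((((F.P K).d * (M′ + ρ′)) : ℕ) : ℝ) * ε₁` (the left-associated spelling of LEAD-H WORD 2 (a) ∕ WORD 3 (3), `mul_assoc` away).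
Hypotheses (the PACK body's member data, letters of ✓p666808): `hnK x₀`, the corner row `ha` (`a ≤ Bᵏx₀ ≤ a + M′ − 1`), `hρ′1 : 1 ≤ ρ′`, the room `hroomW`, `hε₀ : 0 < ε₀`,
`hε : 10⁷·L³·ε₀ ≤ 1`, `hε₁ : 0 ≤ ε₁`, `V hV : PlaqSmall ε₁ V`, `U hU : U ∈ regFibrePr F n K _ ε₀ V`, the one window `hε₁l : 2·((d·(M′+ρ′) : ℕ) : ℝ)·ε₁ ≤ 1`.
HONEST SCOPE.  Quantifier bookkeeping over ONE landed theorem; nothing of Prop. 3 (1.42), Theorem 4, [Balaban1985Averaging], the composers, the packs, the stub or the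
crux is proved here.

References: T. Bałaban, CMP **98** (1985) 17–51 [Balaban1985Averaging] ((8) p.19, (86)–(100) pp.30–32, (110) p.34); CMP **99** (1985) 75–102
[Balaban1985RegularSpaces] ((1.42) p.83, (1.131) p.99); CMP **102** (1985) 277–309 [Balaban1985Variational] ((150)–(156) pp.301–302).
-/

set_option autoImplicit false

noncomputable section

open scoped BigOperators Matrix.Norms.L2Operator
open NormedSpace
open Complex (I)

namespace Summit.QuantumFields.YangMills.Theorems.HalvingHSiteHtopOfMember

open Literature.MathematicalPhysics.QuantumFieldTheory.Balaban1983to89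
open T4Continuum
open Literature.MathematicalPhysics.QuantumFieldTheory.Balaban1983to89.T3ContinuumYM3Torus
open Literature.MathematicalPhysics.QuantumFieldTheory.Balaban1983to89.T3PrintedRegularMinimiser (RegPr regFibrePr)
open MatrixLog (mlog)
open B5Eq118OneStroke (iterBlockOf)
open B7Prop1Explicit renaming Site → LSite
open B7Prop1Explicit (e)
open B7Eq92Concrete (mgauge)
open B8Eq131Cubes (cube gs)
open B8CubeMemberZd (cubeLamS cubeLamB)
open B8Eq184Proof (gaugeExp cfgExp)
open B10Eq27TorusAxialLog (transl rel pull unitsField toUField suIncl gaugeActT axialT)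
open B15Eq112TorusCover (lift)
open Node00 (coverAt)
open Summit.QuantumFields.YangMills.Theorems.Prop8ChartDoubleBar (dbarIterU vframeU)
open HalvingHSiteTopH42Datum (htop_of_knitGauge)

variable (F : T3Family) {n K : ℕ}

/-- ★ **«HTOP-CLOSE» AT ANY BUDGET `t ≥ 2·d(M′+ρ′)·ε₁`**: the composers' `HTOP` socket text (∀ `gJ u₁ W A c₁ c′ κf λ′`, rows 1, 2, 4–9, 14, 15, (top) of the member's
∃-body ⟹ `‖log U̿^{(k)}((U♯)^{g′})(⟨π_k c₋, c.dir⟩)‖ ≤ t` on every `c ∈ cubeLamB L a M′ ρ′ k k k`, `k := K − n`) from the member data and the window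
`2·((d·(M′+ρ′) : ℕ) : ℝ)·ε₁ ≤ 1`, for every `t` with `2·((d·(M′+ρ′) : ℕ) : ℝ)·ε₁ ≤ t` — ✓p666808 `htop_of_knitGauge` re-quantified, then `le_trans`.
[cite: Balaban1985Averaging, (8) p.19, (86)-(100) pp.30-32, (110) p.34; Balaban1985RegularSpaces, (1.42) p.83, (1.131) p.99; Balaban1985Variational, (150)-(156) pp.301-302] -/
theorem htopSocket_of_member_le (hnK : n < K) (x₀ : Site (F.P K) 0) {a : LSite (F.P K).d} {M' ρ' : ℕ} (hρ'1 : 1 ≤ ρ')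
    (ha : ∀ ν, a ν ≤ ((iterBlockOf (K - n) x₀ ν).val : ℤ) ∧ ((iterBlockOf (K - n) x₀ ν).val : ℤ) ≤ a ν + M' - 1)
    (hroomW : 2 * ((F.P K).L ^ (K - n) * (M' + 1) + ρ' * gs (F.P K).L (K - n)) ≤ (F.P K).sitesPerDir 0)
    {ε₀ ε₁ : ℝ} (hε₀ : 0 < ε₀) (hε : 10 ^ 7 * (F.L : ℝ) ^ 3 * ε₀ ≤ 1) (hε₁ : 0 ≤ ε₁)
    (V : GaugeField (F.P n) 0 (Matrix.specialUnitaryGroup (Fin 2) ℂ)) (hV : PlaqSmall ε₁ V)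
    (U : GaugeField (F.P K) 0 (Matrix.specialUnitaryGroup (Fin 2) ℂ)) (hU : U ∈ regFibrePr F n K hnK.le ε₀ V)
    (hε₁l : 2 * ((((F.P K).d * (M' + ρ') : ℕ) : ℝ) * ε₁) ≤ 1)
    {t : ℝ} (ht : 2 * ((((F.P K).d * (M' + ρ') : ℕ) : ℝ) * ε₁) ≤ t) :
    ∀ (gJ : GaugeTransf (F.P K) 0 (Matrix.specialUnitaryGroup (Fin 2) ℂ)) (u₁ : LSite (F.P K).d → (Matrix (Fin 2) (Fin 2) ℂ)ˣ)
      (W : LSite (F.P K).d → Fin (F.P K).d → (Matrix (Fin 2) (Fin 2) ℂ)ˣ) (A : LSite (F.P K).d → Fin (F.P K).d → Matrix (Fin 2) (Fin 2) ℂ) (c₁ c' : ℝ)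
      (κf : (Site (F.P K) 0 → Matrix (Fin 2) (Fin 2) ℂ) → (i : ℕ) → GaugeTransf (F.P K) i (Matrix (Fin 2) (Fin 2) ℂ)ˣ) (lam : LSite (F.P K).d → Matrix (Fin 2) (Fin 2) ℂ),
    (∀ z, ((u₁ z : (Matrix (Fin 2) (Fin 2) ℂ)ˣ) : Matrix (Fin 2) (Fin 2) ℂ) ∈ Matrix.specialUnitaryGroup (Fin 2) ℂ) →
    mgauge (1 : LSite (F.P K).d → Fin (F.P K).d → (Matrix (Fin 2) (Fin 2) ℂ)ˣ) u₁ W = pull (unitsField (toUField (GaugeField.gaugeAct gJ U))) 0 →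
    0 ≤ c' → 8 * 3800 * ((((F.P K).d + 2) * (F.P K).L : ℕ) : ℝ) ^ 2 * c' ≤ 1 → Real.exp c₁ - 1 ≤ ((F.L : ℝ)⁻¹) ^ (K - n) * c' →
    (∀ z ∈ cube (F.P K).L a M' ρ' (K - n) (K - n), ∀ ν : Fin (F.P K).d,
      W z ν = cfgExp (((F.L : ℝ)⁻¹) ^ (K - n)) A z ν ∧ ((F.L : ℝ)⁻¹) ^ (K - n) * ‖A z ν‖ ≤ c₁) →
    (∀ (m : Site (F.P K) 0 → Matrix (Fin 2) (Fin 2) ℂ) (i : ℕ) (y : Site (F.P K) (i + 1)),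
      κf m (i + 1) y = (vframeU (gaugeActT (κf m i) (dbarIterU i (gaugeActT
        (fun s => (u₁ (lift (F.P K) x₀ + rel x₀ s))⁻¹ * Unitary.toUnits (suIncl (gJ s)) : GaugeTransf (F.P K) 0 (Matrix (Fin 2) (Fin 2) ℂ)ˣ)
        (unitsField (toUField U))))) y)⁻¹ * κf m i (emb y) *
        vframeU (dbarIterU i (gaugeActT
          (fun s => (u₁ (lift (F.P K) x₀ + rel x₀ s))⁻¹ * Unitary.toUnits (suIncl (gJ s)) : GaugeTransf (F.P K) 0 (Matrix (Fin 2) (Fin 2) ℂ)ˣ)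
          (unitsField (toUField U)))) y) →
    (∀ (m : Site (F.P K) 0 → Matrix (Fin 2) (Fin 2) ℂ) (x : Site (F.P K) 0), ((κf m 0 x : (Matrix (Fin 2) (Fin 2) ℂ)ˣ) : Matrix (Fin 2) (Fin 2) ℂ) = exp (m x)) →
    (∀ x, IsSelfAdjoint (lam x)) → (∀ x, (lam x).trace = 0) →
    (∀ yc ∈ cubeLamS (F.P K).L a M' ρ' (K - n) (K - n) (K - n),
      κf (((-I) • lam) ∘ fun s : Site (F.P K) 0 => lift (F.P K) x₀ + rel x₀ s) (K - n) (coverAt (F.P K) (K - n) yc) =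
        axialT (dbarIterU (K - n) (gaugeActT
          (fun s => (u₁ (lift (F.P K) x₀ + rel x₀ s))⁻¹ * Unitary.toUnits (suIncl (gJ s)) : GaugeTransf (F.P K) 0 (Matrix (Fin 2) (Fin 2) ℂ)ˣ)
          (unitsField (toUField U)))) (iterBlockOf (K - n) x₀) (coverAt (F.P K) (K - n) yc)) →
    ∀ c ∈ cubeLamB (F.P K).L a M' ρ' (K - n) (K - n) (K - n),
      ‖mlog ((dbarIterU (K - n) (gaugeActT
          (fun s => ((u₁ * gaugeExp lam) (lift (F.P K) x₀ + rel x₀ s))⁻¹ * Unitary.toUnits (suIncl (gJ s)) :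
            GaugeTransf (F.P K) 0 (Matrix (Fin 2) (Fin 2) ℂ)ˣ) (unitsField (toUField U)))
          ⟨coverAt (F.P K) (K - n) c.1, c.2⟩ : (Matrix (Fin 2) (Fin 2) ℂ)ˣ) : Matrix (Fin 2) (Fin 2) ℂ)‖ ≤ t := by
  intro gJ u₁ W A c₁ c' κf lam h1 h2 h4 h5 h6 h7 h8 h9 h14 h15 htop c hc
  exact (htop_of_knitGauge F hnK x₀ hρ'1 ha hroomW hε₀ hε hε₁ V hV U hU gJ h1 h2 h4 h5 h6 h7 h8 h9 h14 h15 htop hε₁l c hc).trans ht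

/-- ★★ **«HTOP-CLOSE» (LEAD-H ★w5-19200 g6 H-NAMER WORD 3 (3)): THE COMPOSERS' `HTOP` SOCKET AT `t := 2 * ((((F.P K).d * (M′ + ρ′) : ℕ) : ℝ) * ε₁)` FROM THE
MEMBER DATA** — the socket text of ★w7-19200 g5's `siteRows_of_sockets_baseT` ∕ ★w3-19200 g8's `siteRows_of_socketsT` VERBATIM (one text for both: they coincide up to the
budget letter), closed by `intro gJ u₁ W A c₁ c' κf lam h1 h2 h4 h5 h6 h7 h8 h9 h14 h15 htop; exact htop_of_knitGauge …` (✓p666808, ★w3-20520 g7).  The member packs v2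
call it positionally: `htopSocket_of_member F hnK x₀ hρ'1 ha hroomW hε₀ hε hε₁ V hV U hU hε₁l`.
[cite: Balaban1985Averaging, (8) p.19, (86)-(100) pp.30-32, (110) p.34; Balaban1985RegularSpaces, (1.42) p.83, (1.131) p.99; Balaban1985Variational, (150)-(156) pp.301-302] -/
theorem htopSocket_of_member (hnK : n < K) (x₀ : Site (F.P K) 0) {a : LSite (F.P K).d} {M' ρ' : ℕ} (hρ'1 : 1 ≤ ρ')
    (ha : ∀ ν, a ν ≤ ((iterBlockOf (K - n) x₀ ν).val : ℤ) ∧ ((iterBlockOf (K - n) x₀ ν).val : ℤ) ≤ a ν + M' - 1)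
    (hroomW : 2 * ((F.P K).L ^ (K - n) * (M' + 1) + ρ' * gs (F.P K).L (K - n)) ≤ (F.P K).sitesPerDir 0)
    {ε₀ ε₁ : ℝ} (hε₀ : 0 < ε₀) (hε : 10 ^ 7 * (F.L : ℝ) ^ 3 * ε₀ ≤ 1) (hε₁ : 0 ≤ ε₁)
    (V : GaugeField (F.P n) 0 (Matrix.specialUnitaryGroup (Fin 2) ℂ)) (hV : PlaqSmall ε₁ V)
    (U : GaugeField (F.P K) 0 (Matrix.specialUnitaryGroup (Fin 2) ℂ)) (hU : U ∈ regFibrePr F n K hnK.le ε₀ V)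
    (hε₁l : 2 * ((((F.P K).d * (M' + ρ') : ℕ) : ℝ) * ε₁) ≤ 1) :
    ∀ (gJ : GaugeTransf (F.P K) 0 (Matrix.specialUnitaryGroup (Fin 2) ℂ)) (u₁ : LSite (F.P K).d → (Matrix (Fin 2) (Fin 2) ℂ)ˣ)
      (W : LSite (F.P K).d → Fin (F.P K).d → (Matrix (Fin 2) (Fin 2) ℂ)ˣ) (A : LSite (F.P K).d → Fin (F.P K).d → Matrix (Fin 2) (Fin 2) ℂ) (c₁ c' : ℝ)
      (κf : (Site (F.P K) 0 → Matrix (Fin 2) (Fin 2) ℂ) → (i : ℕ) → GaugeTransf (F.P K) i (Matrix (Fin 2) (Fin 2) ℂ)ˣ) (lam : LSite (F.P K).d → Matrix (Fin 2) (Fin 2) ℂ),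
    (∀ z, ((u₁ z : (Matrix (Fin 2) (Fin 2) ℂ)ˣ) : Matrix (Fin 2) (Fin 2) ℂ) ∈ Matrix.specialUnitaryGroup (Fin 2) ℂ) →
    mgauge (1 : LSite (F.P K).d → Fin (F.P K).d → (Matrix (Fin 2) (Fin 2) ℂ)ˣ) u₁ W = pull (unitsField (toUField (GaugeField.gaugeAct gJ U))) 0 →
    0 ≤ c' → 8 * 3800 * ((((F.P K).d + 2) * (F.P K).L : ℕ) : ℝ) ^ 2 * c' ≤ 1 → Real.exp c₁ - 1 ≤ ((F.L : ℝ)⁻¹) ^ (K - n) * c' →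
    (∀ z ∈ cube (F.P K).L a M' ρ' (K - n) (K - n), ∀ ν : Fin (F.P K).d,
      W z ν = cfgExp (((F.L : ℝ)⁻¹) ^ (K - n)) A z ν ∧ ((F.L : ℝ)⁻¹) ^ (K - n) * ‖A z ν‖ ≤ c₁) →
    (∀ (m : Site (F.P K) 0 → Matrix (Fin 2) (Fin 2) ℂ) (i : ℕ) (y : Site (F.P K) (i + 1)),
      κf m (i + 1) y = (vframeU (gaugeActT (κf m i) (dbarIterU i (gaugeActT
        (fun s => (u₁ (lift (F.P K) x₀ + rel x₀ s))⁻¹ * Unitary.toUnits (suIncl (gJ s)) : GaugeTransf (F.P K) 0 (Matrix (Fin 2) (Fin 2) ℂ)ˣ)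
        (unitsField (toUField U))))) y)⁻¹ * κf m i (emb y) *
        vframeU (dbarIterU i (gaugeActT
          (fun s => (u₁ (lift (F.P K) x₀ + rel x₀ s))⁻¹ * Unitary.toUnits (suIncl (gJ s)) : GaugeTransf (F.P K) 0 (Matrix (Fin 2) (Fin 2) ℂ)ˣ)
          (unitsField (toUField U)))) y) →
    (∀ (m : Site (F.P K) 0 → Matrix (Fin 2) (Fin 2) ℂ) (x : Site (F.P K) 0), ((κf m 0 x : (Matrix (Fin 2) (Fin 2) ℂ)ˣ) : Matrix (Fin 2) (Fin 2) ℂ) = exp (m x)) →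
    (∀ x, IsSelfAdjoint (lam x)) → (∀ x, (lam x).trace = 0) →
    (∀ yc ∈ cubeLamS (F.P K).L a M' ρ' (K - n) (K - n) (K - n),
      κf (((-I) • lam) ∘ fun s : Site (F.P K) 0 => lift (F.P K) x₀ + rel x₀ s) (K - n) (coverAt (F.P K) (K - n) yc) =
        axialT (dbarIterU (K - n) (gaugeActT
          (fun s => (u₁ (lift (F.P K) x₀ + rel x₀ s))⁻¹ * Unitary.toUnits (suIncl (gJ s)) : GaugeTransf (F.P K) 0 (Matrix (Fin 2) (Fin 2) ℂ)ˣ)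
          (unitsField (toUField U)))) (iterBlockOf (K - n) x₀) (coverAt (F.P K) (K - n) yc)) →
    ∀ c ∈ cubeLamB (F.P K).L a M' ρ' (K - n) (K - n) (K - n),
      ‖mlog ((dbarIterU (K - n) (gaugeActT
          (fun s => ((u₁ * gaugeExp lam) (lift (F.P K) x₀ + rel x₀ s))⁻¹ * Unitary.toUnits (suIncl (gJ s)) :
            GaugeTransf (F.P K) 0 (Matrix (Fin 2) (Fin 2) ℂ)ˣ) (unitsField (toUField U)))
          ⟨coverAt (F.P K) (K - n) c.1, c.2⟩ : (Matrix (Fin 2) (Fin 2) ℂ)ˣ) : Matrix (Fin 2) (Fin 2) ℂ)‖ ≤ 2 * ((((F.P K).d * (M' + ρ') : ℕ) : ℝ) * ε₁) := by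
  intro gJ u₁ W A c₁ c' κf lam h1 h2 h4 h5 h6 h7 h8 h9 h14 h15 htop
  exact htop_of_knitGauge F hnK x₀ hρ'1 ha hroomW hε₀ hε hε₁ V hV U hU gJ h1 h2 h4 h5 h6 h7 h8 h9 h14 h15 htop hε₁l

/-- ★ **«HTOP-CLOSE» AT THE LEFT-ASSOCIATED BUDGET `t := 2 * ((((F.P K).d * (M′ + ρ′)) : ℕ) : ℝ) * ε₁`** (the literal spelling of LEAD-H WORD 2 (a) ∕ WORD 3 (3);
equal to ✓p666808's `2 * (… * ε₁)` by `mul_assoc`) — for packs that instantiate the composers' `t`-letter in this shape.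
[cite: Balaban1985Averaging, (8) p.19, (86)-(100) pp.30-32, (110) p.34; Balaban1985RegularSpaces, (1.42) p.83, (1.131) p.99; Balaban1985Variational, (150)-(156) pp.301-302] -/
theorem htopSocket_of_member' (hnK : n < K) (x₀ : Site (F.P K) 0) {a : LSite (F.P K).d} {M' ρ' : ℕ} (hρ'1 : 1 ≤ ρ')
    (ha : ∀ ν, a ν ≤ ((iterBlockOf (K - n) x₀ ν).val : ℤ) ∧ ((iterBlockOf (K - n) x₀ ν).val : ℤ) ≤ a ν + M' - 1)
    (hroomW : 2 * ((F.P K).L ^ (K - n) * (M' + 1) + ρ' * gs (F.P K).L (K - n)) ≤ (F.P K).sitesPerDir 0)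
    {ε₀ ε₁ : ℝ} (hε₀ : 0 < ε₀) (hε : 10 ^ 7 * (F.L : ℝ) ^ 3 * ε₀ ≤ 1) (hε₁ : 0 ≤ ε₁)
    (V : GaugeField (F.P n) 0 (Matrix.specialUnitaryGroup (Fin 2) ℂ)) (hV : PlaqSmall ε₁ V)
    (U : GaugeField (F.P K) 0 (Matrix.specialUnitaryGroup (Fin 2) ℂ)) (hU : U ∈ regFibrePr F n K hnK.le ε₀ V)
    (hε₁l : 2 * ((((F.P K).d * (M' + ρ') : ℕ) : ℝ) * ε₁) ≤ 1) :
    ∀ (gJ : GaugeTransf (F.P K) 0 (Matrix.specialUnitaryGroup (Fin 2) ℂ)) (u₁ : LSite (F.P K).d → (Matrix (Fin 2) (Fin 2) ℂ)ˣ)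
      (W : LSite (F.P K).d → Fin (F.P K).d → (Matrix (Fin 2) (Fin 2) ℂ)ˣ) (A : LSite (F.P K).d → Fin (F.P K).d → Matrix (Fin 2) (Fin 2) ℂ) (c₁ c' : ℝ)
      (κf : (Site (F.P K) 0 → Matrix (Fin 2) (Fin 2) ℂ) → (i : ℕ) → GaugeTransf (F.P K) i (Matrix (Fin 2) (Fin 2) ℂ)ˣ) (lam : LSite (F.P K).d → Matrix (Fin 2) (Fin 2) ℂ),
    (∀ z, ((u₁ z : (Matrix (Fin 2) (Fin 2) ℂ)ˣ) : Matrix (Fin 2) (Fin 2) ℂ) ∈ Matrix.specialUnitaryGroup (Fin 2) ℂ) →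
    mgauge (1 : LSite (F.P K).d → Fin (F.P K).d → (Matrix (Fin 2) (Fin 2) ℂ)ˣ) u₁ W = pull (unitsField (toUField (GaugeField.gaugeAct gJ U))) 0 →
    0 ≤ c' → 8 * 3800 * ((((F.P K).d + 2) * (F.P K).L : ℕ) : ℝ) ^ 2 * c' ≤ 1 → Real.exp c₁ - 1 ≤ ((F.L : ℝ)⁻¹) ^ (K - n) * c' →
    (∀ z ∈ cube (F.P K).L a M' ρ' (K - n) (K - n), ∀ ν : Fin (F.P K).d,
      W z ν = cfgExp (((F.L : ℝ)⁻¹) ^ (K - n)) A z ν ∧ ((F.L : ℝ)⁻¹) ^ (K - n) * ‖A z ν‖ ≤ c₁) →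
    (∀ (m : Site (F.P K) 0 → Matrix (Fin 2) (Fin 2) ℂ) (i : ℕ) (y : Site (F.P K) (i + 1)),
      κf m (i + 1) y = (vframeU (gaugeActT (κf m i) (dbarIterU i (gaugeActT
        (fun s => (u₁ (lift (F.P K) x₀ + rel x₀ s))⁻¹ * Unitary.toUnits (suIncl (gJ s)) : GaugeTransf (F.P K) 0 (Matrix (Fin 2) (Fin 2) ℂ)ˣ)
        (unitsField (toUField U))))) y)⁻¹ * κf m i (emb y) *
        vframeU (dbarIterU i (gaugeActT
          (fun s => (u₁ (lift (F.P K) x₀ + rel x₀ s))⁻¹ * Unitary.toUnits (suIncl (gJ s)) : GaugeTransf (F.P K) 0 (Matrix (Fin 2) (Fin 2) ℂ)ˣ)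
          (unitsField (toUField U)))) y) →
    (∀ (m : Site (F.P K) 0 → Matrix (Fin 2) (Fin 2) ℂ) (x : Site (F.P K) 0), ((κf m 0 x : (Matrix (Fin 2) (Fin 2) ℂ)ˣ) : Matrix (Fin 2) (Fin 2) ℂ) = exp (m x)) →
    (∀ x, IsSelfAdjoint (lam x)) → (∀ x, (lam x).trace = 0) →
    (∀ yc ∈ cubeLamS (F.P K).L a M' ρ' (K - n) (K - n) (K - n),
      κf (((-I) • lam) ∘ fun s : Site (F.P K) 0 => lift (F.P K) x₀ + rel x₀ s) (K - n) (coverAt (F.P K) (K - n) yc) =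
        axialT (dbarIterU (K - n) (gaugeActT
          (fun s => (u₁ (lift (F.P K) x₀ + rel x₀ s))⁻¹ * Unitary.toUnits (suIncl (gJ s)) : GaugeTransf (F.P K) 0 (Matrix (Fin 2) (Fin 2) ℂ)ˣ)
          (unitsField (toUField U)))) (iterBlockOf (K - n) x₀) (coverAt (F.P K) (K - n) yc)) →
    ∀ c ∈ cubeLamB (F.P K).L a M' ρ' (K - n) (K - n) (K - n),
      ‖mlog ((dbarIterU (K - n) (gaugeActT
          (fun s => ((u₁ * gaugeExp lam) (lift (F.P K) x₀ + rel x₀ s))⁻¹ * Unitary.toUnits (suIncl (gJ s)) :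
            GaugeTransf (F.P K) 0 (Matrix (Fin 2) (Fin 2) ℂ)ˣ) (unitsField (toUField U)))
          ⟨coverAt (F.P K) (K - n) c.1, c.2⟩ : (Matrix (Fin 2) (Fin 2) ℂ)ˣ) : Matrix (Fin 2) (Fin 2) ℂ)‖ ≤ 2 * ((((F.P K).d * (M' + ρ')) : ℕ) : ℝ) * ε₁ := by
  refine htopSocket_of_member_le F hnK x₀ hρ'1 ha hroomW hε₀ hε hε₁ V hV U hU hε₁l (le_of_eq ?_)
  ring

end Summit.QuantumFields.YangMills.Theorems.HalvingHSiteHtopOfMember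

end
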